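/- Copyright: ym3-torus cell, WIDTH seat `ym-ust-19936-w7` (prover, g9), for crux `HistoryTailL` (stmt-QuantumFields-19936),
level-0 prefactor-free infrastructure (T1) of LINE `local_insertion` (#13) ∕ K1.  Released under the licence of the surrounding project. -/
import Summits.QuantumFields.YangMills.Theorems.LocalInsertionTriangularHaarIntegration
import Literature.MathematicalPhysics.QuantumFieldTheory.LatticeAxialGauge
import Literature.MathematicalPhysics.QuantumFieldTheory.WilsonPlaquetteLargeFieldTail
import Literature.MathematicalPhysics.QuantumFieldTheory.StrongCouplingActivities
import HarnessLib

/-!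
# The tree-gauge (axial comb) lower bound for the Wilson partition function of the torus, with the sharp Gaussian count

Support file (`--supports stmt-QuantumFields-19936 --as helper`), step (T1) of the level-0 PREFACTOR-FREE plan of the cell
(memo `PREFACTOR-FREE-LEVEL0-w7g9.md` §1 (b); LEAD ★w1-19936 g7 «T1 GO» 2026-08-29 00:00Z, RULING 00:09:18Z «w7 = door + T1′ +
assembly»): the LOWER half `zlow` of the free-energy sandwich consumed by the door
✓`Literature/…/WilsonPlaquetteExpMomentSandwich.lean` (`PlaquetteExpMoment.integral_exp_mul_plaquette_le_of_sandwich`, hypothesis `hZ`).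

WHAT.  On the torus `Λ_L = (ℤ/Lℤ)^d` (`GaugeConfig d L G`, product Haar probability `π`, `L ≥ 2`), compact second countable `G`,
continuous unitary representation `ρ` on `ℂ^N`, `β ≥ 0`, `r ≥ 0`, `0 < cb ≤ Haar{‖ρ g − 1‖ ≤ r}`:

  ★ `lintegral_boltzmann_ge_treeGauge`:  `∫ e^{−βS(U)} dπ(U) ≥ e^{−β·8N r²·#plaquettes} · cb^{#E_free}`,

`E_free` = the edges of the torus NOT in the axial COMB TREE `{(x,i) : x_k = 0 (k > i), (x_i).val + 1 < L}` — a spanning tree, so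
`#E_free = dL^d − (L^d − 1) = (d−1)L^d + 1` (§4 `card_filter_not_torusComb`).  Compare the tree's link-ball Laplace bound
✓`PlaquetteTail.lintegral_boltzmann_ge`, which constrains ALL `dL^d` edges: gauge fixing along a spanning tree leaves only the non-tree
edges to constrain — the Gaussian count `dim G·(#E − #V + 1)/2` of [Chatterjee2016] Thm 2.1 ∕ Lemma 17.6.

MECHANISM (no definition: the comb gauge ✓`AxialGauge.combGauge` on `ℤ^d`, read on the torus through the periodisation
✓`ZdGaugeConfig.ofTorus` at the integer lift `x̂_k = (x_k).val`).  `G_U(x) := combGauge (ofTorus U) x̂` trivialises every comb edge of the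
torus (§2 `gaugeTransform_comb_eq_one`, from ✓`AxialGauge.combGauge_add_single` — no wrap on the comb) and reads only comb edges (§1
`combGauge_congr_path`, §2 `combGauge_congr_of_comb`: the comb path to a point of `[0,L)^d` stays below its endpoint).  Hence the gauge-fixed
non-comb variables `G_U(x)·U(x,i)·G_U(x+e_i)⁻¹` are words with a private letter `U(x,i)` whose outer letters read only comb variables, so by
the triangular identity ✓`TriangularHaar.integral_prod_words_eq` (★w4-19936 g10, p680842; all ranks equal) they are INDEPENDENT and
Haar-distributed — [Chatterjee2016] Lemma 9.3 on the torus: §3 `measureReal_forall_gaugeFixed_mem_eq`,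
`π{every gauge-fixed non-comb edge ∈ B} = Haar(B)^{#E_free}` EXACTLY.  On that event (with `B` the ball) every edge of `U^{G_U}` is in the
ball (`1` on the comb), so `S(U) = S(U^{G_U}) ≤ 8Nr²·#plaquettes` (✓`wilsonAction_gaugeTransform`, ✓`PlaquetteTail.wilsonAction_le_of_ball`).

PRIOR ART IN THE TREE (located; not imported — `d` is hard-wired there).  Route `LangevinControlUV` (crux 16204) landed the whole torus
free-energy sandwich for `d = 4` on this very carrier: ✓`…Theorems.LangevinControlUVFemtoCurvatureTwoPointCTorusCombGauge` (comb holonomies on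
`Site 4 L`), ✓`…CTorusLower` (`FemtoCurvatureTwoPointC.TorusGauge.exp_mul_pow_le_partitionFunction_toReal_comb`: `e^{−8βδ²#plaq}·(C₁δ^D)^{3L⁴+1}
≤ Z_L(β)` — the `d = 4` instance of ★ below, with the small-ball constant of ✓`FreeEnergyLogCoefficient.exists_haar_gball_ge`), ✓`…CTorusUpper`
∕ ✓`…COneLinkLaplace` (`oneLinkLaplace_le_rpow`: `∫ e^{−β(N − Re tr ρ)} dσ ≤ C β^{−D∕2}`, `D = dimE ρ`, every faithful unitary `ρ`).  Route
`LuscherReduction` has the `d = 3`, `G = SU(2)` unit-Jacobian statement with its own `treeFix ∕ killTree` definitions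
(✓`…LuscherReductionRunningReductionTreeGaugeHaar`).  THIS FILE: every `d` (the cell needs `d = 3`), every compact `G`, no definition, the
`zlow` letter of the door verbatim, via the `ℤ^d` comb of ✓`LatticeAxialGauge` and the rank-form identity of ✓p680842.

HONEST SCOPE.  Folklore gauge fixing (S. Chatterjee, J. Funct. Anal. 271 (2016) 2944–3005 = arXiv:1602.01222, §9 Prop. 9.2 ∕ Lemma 9.3,
Lemma 17.1; T. Bałaban, CMP 109 (1987) (0.14)–(0.15), the link ball).  A lower bound for a partition function, nothing more: nothing of
LINE #13's stubs, of `HistoryTailL`, of any crux is proved.  CAVEAT (LEAD g7): in the sandwich the residual `β^{c/L}` after the `L^d`-th root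
is not coupling-uniform at fixed small volume; nothing here is worded as a stub.  YM₃ on T³ is rung R3 of the ladder — not d = 4, not
infinite volume, not a mass gap, not Clay.  THEOREMS ONLY (0 `def`, 0 `sorry`); count-neutral.
-/

noncomputable section

open MeasureTheory Finset Function
open scoped ENNReal Matrix.Norms.L2Operator

namespace Summit.QuantumFields.YangMills.Theorems.LocalInsertion.TorusTreeGauge

open Literature.MathematicalPhysics.QuantumFieldTheory
open Literature.MathematicalPhysics.QuantumFieldTheory.AxialGauge
open Literature.MathematicalPhysics.QuantumFieldTheory.PlaquetteTail (wilsonAction_le_of_ball)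
open Summit.QuantumFields.YangMills.Theorems.LocalInsertion.TriangularHaar (integral_prod_words_eq)

/-! ## §1 The comb gauge reads only the edges of the comb path (refinement of ✓`AxialGauge.combGauge_congr`) -/

section CombPath

variable {d : ℕ} {G : Type*} [Group G]

/-- **The comb gauge `G_U(z)` only reads the comb edges ON THE COMB PATH to `z`**: the `j`-th leg reads the edges
`(combBase j z + t e_j, j)`, `t < (z_j).toNat`. [cite: Chatterjee2016, Lemma 9.3 (proof)] -/
theorem combGauge_congr_path {U U' : ZdGaugeConfig d G} (z : Literature.Probability.LatticeModels.Site d)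
    (h : ∀ (j : Fin d) (t : ℕ), t < (z j).toNat →
      U (combBase j z + Pi.single j (t : ℤ), j) = U' (combBase j z + Pi.single j (t : ℤ), j)) :
    combGauge U z = combGauge U' z := by
  suffices hj : ∀ j, combGaugeAux U z j = combGaugeAux U' z j from hj d
  intro j
  induction j with
  | zero => rfl
  | succ j ih =>
    simp only [combGaugeAux, ih]
    by_cases hjd : j < d
    · rw [dif_pos hjd, dif_pos hjd, line_congr _ _ _ fun t ht => h ⟨j, hjd⟩ t ht]
    · rw [dif_neg hjd, dif_neg hjd]

end CombPath

/-! ## §2 The comb of the torus, read through the periodisation `ofTorus` at the lift `x̂_k = (x_k).val` -/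

section Torus

variable {d L : ℕ} [NeZero L] [Fact (1 < L)] {G : Type*} [Group G]

omit [Fact (1 < L)] in
/-- The lift `x̂` of a torus site casts back to the site. [folklore] -/
theorem intCast_lift (x : Site d L) : (fun k => (((x k).val : ℤ) : ZMod L)) = x := by
  funext k; rw [Int.cast_natCast, ZMod.natCast_zmod_val]

omit [Fact (1 < L)] [Group G] in
/-- The periodisation read at the lift of a torus edge is the torus variable: `(ofTorus U)(x̂, i) = U(x, i)`. [folklore] -/
theorem ofTorus_lift (U : GaugeConfig d L G) (x : Site d L) (i : Fin d) :
    ZdGaugeConfig.ofTorus U (fun k => ((x k).val : ℤ), i) = U (x, i) := by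
  simp only [ZdGaugeConfig.ofTorus, intCast_lift]

omit [NeZero L] in
/-- For a torus edge `(x, i)` without wrap (`(x_i).val + 1 < L`) the lift of `x + e_i` is `x̂ + e_i`. [folklore] -/
theorem lift_shift {x : Site d L} {i : Fin d} (hw : (x i).val + 1 < L) :
    (fun k => (((x.shift i) k).val : ℤ)) = (fun k => ((x k).val : ℤ)) + Pi.single i (1 : ℤ) := by
  funext k
  simp only [Site.shift, Pi.add_apply]
  by_cases hk : k = i
  · subst hk
    rw [Pi.single_eq_same, Pi.single_eq_same]
    have h1 : (1 : ZMod L).val = 1 := ZMod.val_one L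
    have : (x k + 1).val = (x k).val + 1 := by
      rw [ZMod.val_add_of_lt (by rw [h1]; exact hw), h1]
    rw [this]; push_cast; ring
  · rw [Pi.single_eq_of_ne hk, Pi.single_eq_of_ne hk, add_zero, add_zero]

/-- **The comb gauge trivialises the comb edges of the torus** ([Chatterjee2016] Prop. 9.2 read on the torus): for `(x,i)` with
`x_k = 0` (`k > i`) and `(x_i).val + 1 < L`, `G_U(x) · U(x,i) · G_U(x + e_i)⁻¹ = 1`. [cite: Chatterjee2016, Prop. 9.2] -/
theorem gaugeTransform_comb_eq_one (U : GaugeConfig d L G) {x : Site d L} {i : Fin d}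
    (hc : ∀ k : Fin d, i < k → x k = 0) (hw : (x i).val + 1 < L) :
    gaugeTransform (fun y : Site d L => combGauge (ZdGaugeConfig.ofTorus U) (fun k => ((y k).val : ℤ))) U (x, i) = 1 := by
  have hcZ : IsComb ((fun k => ((x k).val : ℤ)), i) := fun k hk => by
    show ((x k).val : ℤ) = 0
    rw [hc k hk, ZMod.val_zero, Nat.cast_zero]
  have hx0 : (0 : ℤ) ≤ ((x i).val : ℤ) := by positivity
  show combGauge (ZdGaugeConfig.ofTorus U) (fun k => ((x k).val : ℤ)) * U (x, i) *
      (combGauge (ZdGaugeConfig.ofTorus U) (fun k => (((x.shift i) k).val : ℤ)))⁻¹ = 1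
  rw [lift_shift hw, combGauge_add_single hcZ hx0, ofTorus_lift, mul_inv_cancel]

omit [Fact (1 < L)] in
/-- **The comb gauge of the torus reads only the comb edges of the torus**: if `U, V` agree on every comb edge
(`x_k = 0` for `k > i`, `(x_i).val + 1 < L`) then `G_U(z) = G_V(z)` at every site — the comb path to `ẑ ∈ [0,L)^d` consists of lifts of
comb edges (`y_j = t ≤ ẑ_j − 1 ≤ L − 2`, no wrap). [cite: Chatterjee2016, Lemma 9.3 (proof)] -/
theorem combGauge_congr_of_comb {U V : GaugeConfig d L G}
    (h : ∀ e : Edge d L, ((∀ k : Fin d, e.2 < k → e.1 k = 0) ∧ (e.1 e.2).val + 1 < L) → U e = V e) (z : Site d L) :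
    combGauge (ZdGaugeConfig.ofTorus U) (fun k => ((z k).val : ℤ)) =
      combGauge (ZdGaugeConfig.ofTorus V) (fun k => ((z k).val : ℤ)) := by
  refine combGauge_congr_path _ fun j t ht => ?_
  simp only [ZdGaugeConfig.ofTorus]
  have htz : t < (z j).val := by
    have h' := ht
    simp only [Int.toNat_natCast] at h'
    exact h'
  have hzL : (z j).val < L := ZMod.val_lt _
  refine h _ ⟨fun k (hk : j < k) => ?_, ?_⟩
  · show (((combBase j (fun k => ((z k).val : ℤ)) + Pi.single j (t : ℤ) :
        Literature.Probability.LatticeModels.Site d) k : ℤ) : ZMod L) = 0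
    simp only [Pi.add_apply, combBase, if_neg (not_lt.2 hk.le), Pi.single_eq_of_ne (ne_of_gt hk), add_zero, Int.cast_zero]
  · show ((((combBase j (fun k => ((z k).val : ℤ)) + Pi.single j (t : ℤ) :
        Literature.Probability.LatticeModels.Site d) j : ℤ) : ZMod L)).val + 1 < L
    simp only [Pi.add_apply, combBase, lt_irrefl, if_false, Pi.single_eq_same, zero_add, Int.cast_natCast]
    rw [ZMod.val_natCast, Nat.mod_eq_of_lt (lt_trans htz hzL)]
    omega

end Torus

/-! ## §3 ★ Lemma 9.3 on the torus and the tree-gauge lower bound -/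

section Measurability

variable {d L : ℕ} {G : Type*} [MeasurableSpace G]

/-- The periodisation `ofTorus` is measurable. [folklore] -/
theorem measurable_ofTorus : Measurable (ZdGaugeConfig.ofTorus : GaugeConfig d L G → ZdGaugeConfig d G) :=
  measurable_pi_lambda _ fun _ => measurable_pi_apply _

end Measurability

section LowerBound

variable {d L m : ℕ} [NeZero L] [Fact (1 < L)]
variable {G : Type*} [Group G] [TopologicalSpace G] [IsTopologicalGroup G] [CompactSpace G]
  [MeasurableSpace G] [BorelSpace G] [SecondCountableTopology G]

omit [NeZero L] [Fact (1 < L)] [CompactSpace G] in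
/-- The torus comb gauge `U ↦ G_U(z)` is measurable. [folklore] -/
theorem measurable_combGauge_ofTorus (z : Site d L) :
    Measurable fun U : GaugeConfig d L G => combGauge (ZdGaugeConfig.ofTorus U) (fun k => ((z k).val : ℤ)) :=
  (measurable_combGauge _).comp measurable_ofTorus

omit [NeZero L] [Fact (1 < L)] [CompactSpace G] in
/-- The gauge-fixed variable `U ↦ (U^{G_U})(e) = G_U(x)·U(e)·G_U(x+e_i)⁻¹` is measurable. [folklore] -/
theorem measurable_gaugeTransform_comb (e : Edge d L) :
    Measurable fun U : GaugeConfig d L G =>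
      gaugeTransform (fun y : Site d L => combGauge (ZdGaugeConfig.ofTorus U) (fun k => ((y k).val : ℤ))) U e :=
  ((measurable_combGauge_ofTorus e.1).mul (measurable_pi_apply e)).mul (measurable_combGauge_ofTorus _).inv

omit [Fact (1 < L)] in
/-- ★ **LEMMA 9.3 ON THE TORUS (the gauge-fixed non-comb variables are independent and Haar-distributed).**  For every measurable
`B ⊆ G`, with `G_U(x) = combGauge (ofTorus U) x̂` the comb gauge and `E_free` the non-comb edges of the torus,
`π{U | ∀ e ∈ E_free, (U^{G_U})(e) ∈ B} = Haar(B)^{#E_free}` EXACTLY. [cite: Chatterjee2016, Lemma 9.3] -/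
theorem measureReal_forall_gaugeFixed_mem_eq {B : Set G} (hBm : MeasurableSet B) :
    (Measure.pi fun _ : Edge d L => haarProbability G).real
        {U : GaugeConfig d L G | ∀ e ∈ (Finset.univ : Finset (Edge d L)).filter
            (fun e => ¬ ((∀ k : Fin d, e.2 < k → e.1 k = 0) ∧ (e.1 e.2).val + 1 < L)),
          gaugeTransform (fun y : Site d L => combGauge (ZdGaugeConfig.ofTorus U) (fun k => ((y k).val : ℤ))) U e ∈ B} =
      (haarProbability G).real B ^
        #((Finset.univ : Finset (Edge d L)).filter
          fun e => ¬ ((∀ k : Fin d, e.2 < k → e.1 k = 0) ∧ (e.1 e.2).val + 1 < L)) := by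
  classical
  set π : Measure (GaugeConfig d L G) := Measure.pi fun _ : Edge d L => haarProbability G with hπ
  set tc : Edge d L → Prop := fun e => (∀ k : Fin d, e.2 < k → e.1 k = 0) ∧ (e.1 e.2).val + 1 < L with htc
  set F : Finset (Edge d L) := (Finset.univ : Finset (Edge d L)).filter fun e => ¬ tc e with hF
  set Gg : GaugeConfig d L G → Site d L → G :=
    fun U y => combGauge (ZdGaugeConfig.ofTorus U) (fun k => ((y k).val : ℤ)) with hGg
  set A : Set (GaugeConfig d L G) := {U | ∀ e ∈ F, gaugeTransform (Gg U) U e ∈ B} with hA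
  have hmeas : ∀ e, Measurable fun U : GaugeConfig d L G => gaugeTransform (Gg U) U e :=
    fun e => measurable_gaugeTransform_comb e
  have hAm : MeasurableSet A := by
    have : A = ⋂ e ∈ F, (fun U => gaugeTransform (Gg U) U e) ⁻¹' B := by ext U; simp [hA]
    rw [this]
    exact MeasurableSet.biInter (Set.to_countable _) fun e _ => hmeas e hBm
  -- the product of indicators is the indicator of `A`
  have hindA : ∀ U : GaugeConfig d L G,
      (∏ e ∈ F, B.indicator (1 : G → ℝ) (Gg U e.1 * U e * (Gg U (e.1.shift e.2))⁻¹)) = A.indicator 1 U := by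
    intro U
    by_cases hU : U ∈ A
    · rw [Set.indicator_of_mem hU, Pi.one_apply]
      exact Finset.prod_eq_one fun e he => by
        rw [Set.indicator_of_mem (show Gg U e.1 * U e * (Gg U (e.1.shift e.2))⁻¹ ∈ B from hU e he), Pi.one_apply]
    · rw [Set.indicator_of_notMem hU]
      simp only [hA, Set.mem_setOf_eq, not_forall] at hU
      obtain ⟨e, he, hne⟩ := hU
      have hne' : Gg U e.1 * U e * (Gg U (e.1.shift e.2))⁻¹ ∉ B := hne
      exact Finset.prod_eq_zero he (by rw [Set.indicator_of_notMem hne'])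
  -- the outer letters read only comb edges: the dependency hypothesis of the triangular identity (all ranks `0`)
  have hGdep : ∀ e ∈ F, ∀ z : Site d L,
      DependsOn (fun U : GaugeConfig d L G => Gg U z) {j : Edge d L | j ≠ e ∧ (j ∈ F → (0 : ℕ) < 0)} := by
    intro e he z U V hUV
    have he' : ¬ tc e := by simpa [hF] using he
    refine combGauge_congr_of_comb (fun j hj => hUV j ⟨?_, fun hjF => ?_⟩) z
    · rintro rfl; exact he' hj
    · exact absurd hj (Finset.mem_filter.1 hjF).2
  have hprod := integral_prod_words_eq (ι := Edge d L) (haarProbability G) (fun _ => (0 : ℕ)) F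
    (a := fun e U => Gg U e.1) (b := fun e U => (Gg U (e.1.shift e.2))⁻¹)
    (fun e => measurable_combGauge_ofTorus e.1) (fun e => (measurable_combGauge_ofTorus _).inv)
    (fun e he => ⟨hGdep e he e.1, fun U V hUV => by simp only [hGdep e he (e.1.shift e.2) hUV]⟩)
    (w := fun _ => B.indicator (1 : G → ℝ)) (fun _ => measurable_one.indicator hBm)
    (fun _ g => Set.indicator_nonneg (fun _ _ => zero_le_one) g) (B := 1)
    (fun _ g => Set.indicator_apply_le' (fun _ => le_rfl) (fun _ => zero_le_one))
  simp only [hindA, integral_indicator_one hBm, Finset.prod_const] at hprod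
  rw [← hprod, integral_indicator_one hAm]

variable (ρ : G →* Matrix (Fin m) (Fin m) ℂ) (hρu : ∀ g, ρ g ∈ Matrix.unitaryGroup (Fin m) ℂ)

include hρu in
/-- ★ **THE TREE-GAUGE LOWER BOUND WITH THE SHARP GAUSSIAN COUNT.**  `L ≥ 2`, `β ≥ 0`, `r ≥ 0`, `0 < cb ≤ Haar{‖ρ g − 1‖ ≤ r}`:
`∫ e^{−βS} dπ ≥ e^{−β·#plaquettes·8Nr²} · cb^{#E_free}`, `E_free` = the non-comb edges of the torus (`(d−1)L^d + 1` of them,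
`card_filter_not_torusComb`) — the `zlow` of ✓`PlaquetteExpMoment.integral_exp_mul_plaquette_le_of_sandwich`.
[cite: Chatterjee2016, Lemma 9.3, Lemma 17.6; Balaban1987RG1, (0.15) p.254] -/
theorem lintegral_boltzmann_ge_treeGauge [NeZero m] (hρc : Continuous ρ) {β : ℝ} (hβ : 0 ≤ β) {r cb : ℝ} (hr : 0 ≤ r)
    (hcb : 0 < cb) (hball : ENNReal.ofReal cb ≤ haarProbability G {g : G | ‖ρ g - 1‖ ≤ r}) :
    ENNReal.ofReal (Real.exp (-(β * ((Fintype.card (Plaquette d L) : ℝ) * (8 * m * r ^ 2)))) *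
          cb ^ #((Finset.univ : Finset (Edge d L)).filter
            fun e => ¬ ((∀ k : Fin d, e.2 < k → e.1 k = 0) ∧ (e.1 e.2).val + 1 < L))) ≤
      ∫⁻ U, ENNReal.ofReal (Real.exp (-β * wilsonAction ρ U)) ∂(Measure.pi fun _ : Edge d L => haarProbability G) := by
  classical
  set π : Measure (GaugeConfig d L G) := Measure.pi fun _ : Edge d L => haarProbability G with hπ
  set tc : Edge d L → Prop := fun e => (∀ k : Fin d, e.2 < k → e.1 k = 0) ∧ (e.1 e.2).val + 1 < L with htc
  set F : Finset (Edge d L) := (Finset.univ : Finset (Edge d L)).filter fun e => ¬ tc e with hF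
  set Gg : GaugeConfig d L G → Site d L → G :=
    fun U y => combGauge (ZdGaugeConfig.ofTorus U) (fun k => ((y k).val : ℤ)) with hGg
  set B : Set G := {g : G | ‖ρ g - 1‖ ≤ r} with hB
  have hBm : MeasurableSet B := (isClosed_le ((hρc.sub continuous_const).norm) continuous_const).measurableSet
  set A : Set (GaugeConfig d L G) := {U | ∀ e ∈ F, gaugeTransform (Gg U) U e ∈ B} with hA
  have hAm : MeasurableSet A := by
    have : A = ⋂ e ∈ F, (fun U => gaugeTransform (Gg U) U e) ⁻¹' B := by ext U; simp [hA]
    rw [this]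
    exact MeasurableSet.biInter (Set.to_countable _) fun e _ => measurable_gaugeTransform_comb e hBm
  -- (i) on `A`, EVERY edge of the gauge-fixed configuration is in the ball (`1` on the comb)
  have hallball : ∀ U ∈ A, ∀ e : Edge d L, ‖ρ (gaugeTransform (Gg U) U e) - 1‖ ≤ r := by
    intro U hU e
    by_cases he : tc e
    · obtain ⟨x, i⟩ := e
      rw [show gaugeTransform (Gg U) U (x, i) = 1 from gaugeTransform_comb_eq_one U he.1 he.2, map_one, sub_self, norm_zero]
      exact hr
    · exact hU e (by simp [hF, he])
  -- (ii) hence the Boltzmann weight is bounded below on `A`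
  set c₀ : ℝ := Real.exp (-(β * ((Fintype.card (Plaquette d L) : ℝ) * (8 * m * r ^ 2)))) with hc₀
  have hlow : ∀ U ∈ A, ENNReal.ofReal c₀ ≤ ENNReal.ofReal (Real.exp (-β * wilsonAction ρ U)) := by
    intro U hU
    refine ENNReal.ofReal_le_ofReal (Real.exp_le_exp.mpr ?_)
    have h := wilsonAction_le_of_ball ρ hρu (U := gaugeTransform (Gg U) U) (hallball U hU)
    rw [wilsonAction_gaugeTransform] at h
    nlinarith
  -- (iii) the probability of `A` is EXACTLY `Haar(B)^{#F}` (Lemma 9.3 on the torus)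
  have hπA : π.real A = (haarProbability G).real B ^ #F := measureReal_forall_gaugeFixed_mem_eq hBm
  have hcb' : cb ≤ (haarProbability G).real B :=
    (ENNReal.ofReal_le_iff_le_toReal (measure_ne_top _ _)).1 hball
  -- (iv) assemble: `∫ e^{−βS} ≥ ∫_A e^{−βS} ≥ c₀ · π(A) ≥ c₀ · cb^{#F}`
  calc ENNReal.ofReal (c₀ * cb ^ #F) = ENNReal.ofReal c₀ * ENNReal.ofReal (cb ^ #F) := ENNReal.ofReal_mul (Real.exp_pos _).le
    _ ≤ ENNReal.ofReal c₀ * ENNReal.ofReal ((haarProbability G).real B ^ #F) :=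
        mul_le_mul_right (ENNReal.ofReal_le_ofReal (pow_le_pow_left₀ hcb.le hcb' _)) _
    _ = ENNReal.ofReal c₀ * π A := by rw [← hπA, ofReal_measureReal]
    _ = ∫⁻ U in A, ENNReal.ofReal c₀ ∂π := by rw [setLIntegral_const, mul_comm]
    _ ≤ ∫⁻ U in A, ENNReal.ofReal (Real.exp (-β * wilsonAction ρ U)) ∂π := setLIntegral_mono' hAm fun U hU => hlow U hU
    _ ≤ ∫⁻ U, ENNReal.ofReal (Real.exp (-β * wilsonAction ρ U)) ∂π := setLIntegral_le_lintegral _ _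

end LowerBound

/-! ## §4 Counting: the comb is a spanning tree of the torus, `#E_free = (d−1)L^d + 1` -/

section Counting

variable {d L : ℕ} [NeZero L]

/-- The lift `(x, i) ↦ (x̂, i)` of torus edges to `ℤ^d` edges is injective. [folklore] -/
theorem lift_injective :
    Function.Injective fun e : Edge d L => ((fun k => ((e.1 k).val : ℤ)), e.2) := by
  rintro ⟨x, i⟩ ⟨y, j⟩ h
  simp only [Prod.mk.injEq] at h
  obtain ⟨h1, rfl⟩ := h
  refine Prod.ext (funext fun k => ZMod.val_injective L ?_) rfl
  have := congr_fun h1 k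
  exact_mod_cast this

/-- **The comb edges of the torus lift exactly onto the comb edges `E_L^0` of the box `B_L = [0,L)^d`** (✓`AxialGauge.combEdges`).
[cite: Chatterjee2016, Lemma 17.1] -/
theorem image_lift_filter_torusComb :
    ((Finset.univ : Finset (Edge d L)).filter
        (fun e => (∀ k : Fin d, e.2 < k → e.1 k = 0) ∧ (e.1 e.2).val + 1 < L)).image
      (fun e : Edge d L => ((fun k => ((e.1 k).val : ℤ)), e.2)) = combEdges d L := by
  classical
  ext ⟨y, i⟩
  simp only [Finset.mem_image, Finset.mem_filter, Finset.mem_univ, true_and, combEdges, Prod.mk.injEq]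
  constructor
  · rintro ⟨⟨x, j⟩, ⟨hc, hw⟩, hxy, rfl⟩
    subst hxy
    have hc' : ∀ k : Fin d, j < k → x k = 0 := hc
    have hw' : (x j).val + 1 < L := hw
    refine ⟨mem_boxEdges_iff.2 ⟨fun k => ⟨by positivity, by exact_mod_cast ZMod.val_lt (x k)⟩, by exact_mod_cast hw'⟩,
      fun k (hk : j < k) => ?_⟩
    show ((x k).val : ℤ) = 0
    rw [hc' k hk, ZMod.val_zero, Nat.cast_zero]
  · rintro ⟨hbox, hc⟩
    obtain ⟨h1, h2⟩ := mem_boxEdges_iff.1 hbox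
    have hval : ∀ k, ((((y k : ℤ) : ZMod L)).val : ℤ) = y k := fun k => by
      rw [ZMod.val_intCast, Int.emod_eq_of_lt (h1 k).1 (h1 k).2]
    refine ⟨((fun k => ((y k : ℤ) : ZMod L)), i), ⟨fun k hk => ?_, ?_⟩, funext fun k => hval k, rfl⟩
    · show ((y k : ℤ) : ZMod L) = 0
      rw [show y k = 0 from hc k hk, Int.cast_zero]
    · have := hval i
      show (((y i : ℤ) : ZMod L)).val + 1 < L
      omega

/-- **The comb is a spanning tree of the torus**: `#{comb edges} = L^d − 1`. [cite: Chatterjee2016, Lemma 17.1] -/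
theorem card_filter_torusComb :
    #((Finset.univ : Finset (Edge d L)).filter
        fun e => (∀ k : Fin d, e.2 < k → e.1 k = 0) ∧ (e.1 e.2).val + 1 < L) = L ^ d - 1 := by
  classical
  rw [← card_combEdges (d := d) L, ← image_lift_filter_torusComb, Finset.card_image_of_injective _ lift_injective]

/-- **THE SHARP COUNT OF THE FREE EDGES**: `#E_free = #edges − #comb = dL^d − (L^d − 1) = (d − 1)L^d + 1` (`d ≥ 1`).
[cite: Chatterjee2016, Lemma 17.1] -/
theorem card_filter_not_torusComb [NeZero d] :
    #((Finset.univ : Finset (Edge d L)).filter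
        fun e => ¬ ((∀ k : Fin d, e.2 < k → e.1 k = 0) ∧ (e.1 e.2).val + 1 < L)) = (d - 1) * L ^ d + 1 := by
  classical
  have h := Finset.card_filter_add_card_filter_not
    (s := (Finset.univ : Finset (Edge d L))) (fun e => (∀ k : Fin d, e.2 < k → e.1 k = 0) ∧ (e.1 e.2).val + 1 < L)
  have hE : #(Finset.univ : Finset (Edge d L)) = L ^ d * d := by
    rw [Finset.card_univ, Fintype.card_prod, Fintype.card_pi, Finset.prod_const, ZMod.card, Finset.card_univ,
      Fintype.card_fin]
  rw [card_filter_torusComb, hE] at h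
  have hd : 1 ≤ d := Nat.pos_of_ne_zero (NeZero.ne d)
  have hL : 1 ≤ L ^ d := Nat.one_le_pow _ _ (Nat.pos_of_ne_zero (NeZero.ne L))
  have key : (d - 1) * L ^ d + 1 + (L ^ d - 1) = L ^ d * d := by
    obtain ⟨d', rfl⟩ : ∃ d', d = d' + 1 := ⟨d - 1, by omega⟩
    obtain ⟨M, hM⟩ : ∃ M, L ^ (d' + 1) = M + 1 := ⟨L ^ (d' + 1) - 1, by omega⟩
    rw [hM]
    simp only [Nat.add_sub_cancel]
    ring
  omega

/-- The count as a real number: `#E_free = (d − 1)·L^d + 1`. [cite: Chatterjee2016, Lemma 17.1] -/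
theorem card_filter_not_torusComb_real [NeZero d] :
    (#((Finset.univ : Finset (Edge d L)).filter
        fun e => ¬ ((∀ k : Fin d, e.2 < k → e.1 k = 0) ∧ (e.1 e.2).val + 1 < L)) : ℝ) = ((d : ℝ) - 1) * (L : ℝ) ^ d + 1 := by
  rw [card_filter_not_torusComb]
  have hd : 1 ≤ d := Nat.pos_of_ne_zero (NeZero.ne d)
  push_cast [Nat.cast_sub hd]
  ring

end Counting

end Summit.QuantumFields.YangMills.Theorems.LocalInsertion.TorusTreeGauge

end
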